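import Mathlib.Analysis.InnerProductSpace.Adjoint
import HarnessLib

/-!
# K1L_D (stmt-AnomalousDissipation-27980), line «onelevel-design»: the LOSS CURRENCY of the modulated cell clause (V_mod) — quadratic-form
# algebra and COMPOSITION across a frame reset (helper; `--supports … --as helper`; lead-k1l-onelevel-p1 g4)

Memo L10 / draft `Cruxes/…/Lines/onelevel_Vmod_draft.lean` (tenure D26-10, γ2): the modulated clause is stated in the two intrinsic losses of the
COARSE window map `T` on a real Hilbert space — the forward loss `q_T(x) = ‖x‖² − ‖T x‖²` and the adjoint loss `q*_T(ζ) = ‖ζ‖² − ‖T† ζ‖²`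
— as `|⟪(U − T)x, ζ⟫| ≤ η √q_T(x) √q*_T(ζ)` for all `x, ζ`.  This file proves, for contractions on any real Hilbert space:

* `norm_adjoint_le` — the adjoint of a contraction is a contraction;
* `loss_nonneg`, `loss_add_le` — the loss is a nonnegative quadratic form: `q(a+b) ≤ 2q(a) + 2q(b)` (parallelogram law);
* `loss_le_loss_comp`, `lossAdj_adjoint_le_lossAdj_comp`, `lossAdj_le_lossAdj_comp` — monotonicity under composition (telescoping);
* `norm_sub_le_of_lossBound` — the clause tested against `ζ := (U−T)x` itself gives the STRONG bound `‖(U−T)x‖ ≤ η √q_T(x)`;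
* **`lossBound_comp`** — COMPOSITION: if `(U₁,T₁)` and `(U₂,T₂)` satisfy the loss-currency bound with `η₁, η₂`, then `(U₂U₁, T₂T₁)` satisfies it
  with `(η₁ + η₂)·√(2 + 2η₁²)` against the losses of `T₂T₁` — two refresh windows cost a constant factor, nothing else (contrast: the Fourier
  N-currency does not compose across a frame reset, memo L9 §3(b)).

Pure Hilbert-space algebra; NOT a proof of (V_mod), of §9z, of the crux, or of AD; rung F-D1.A0.
-/

set_option linter.dupNamespace false  -- the summit-side namespace `Summit.AnomalousDissipation.AnomalousDissipation.…` repeats a component by design (D-0017)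

noncomputable section

namespace Summit.AnomalousDissipation.AnomalousDissipation.Theorems.SolenoidalFractalHomogenisation.LagrangianStep.LossCurrency

open scoped InnerProductSpace

variable {H : Type*} [NormedAddCommGroup H] [InnerProductSpace ℝ H] [CompleteSpace H]

/-! ## §1 Contractions and their adjoints -/

/-- The adjoint of a contraction is a contraction (pointwise: `‖T†y‖² = ⟪y, T T† y⟫ ≤ ‖y‖‖T†y‖`). -/
theorem norm_adjoint_le {T : H →L[ℝ] H} (hT : ∀ y, ‖T y‖ ≤ ‖y‖) (y : H) : ‖ContinuousLinearMap.adjoint T y‖ ≤ ‖y‖ := by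
  set z := ContinuousLinearMap.adjoint T y with hz
  have h1 : ‖z‖ ^ 2 = ⟪y, T z⟫_ℝ := by
    rw [← ContinuousLinearMap.adjoint_inner_left, ← hz, real_inner_self_eq_norm_sq]
  have h2 : ‖z‖ ^ 2 ≤ ‖y‖ * ‖z‖ :=
    calc ‖z‖ ^ 2 = ⟪y, T z⟫_ℝ := h1
      _ ≤ ‖y‖ * ‖T z‖ := real_inner_le_norm _ _
      _ ≤ ‖y‖ * ‖z‖ := mul_le_mul_of_nonneg_left (hT z) (norm_nonneg _)
  by_cases h0 : ‖z‖ = 0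
  · rw [h0]; exact norm_nonneg _
  · have hp : 0 < ‖z‖ := lt_of_le_of_ne (norm_nonneg _) (Ne.symm h0)
    nlinarith

omit [CompleteSpace H] in
/-- The FORWARD LOSS `‖x‖² − ‖T x‖²` of a contraction is nonnegative. -/
theorem loss_nonneg {T : H →L[ℝ] H} (hT : ∀ y, ‖T y‖ ≤ ‖y‖) (x : H) : 0 ≤ ‖x‖ ^ 2 - ‖T x‖ ^ 2 := by
  have := hT x
  nlinarith [norm_nonneg (T x)]

/-- The ADJOINT LOSS `‖ζ‖² − ‖T† ζ‖²` of a contraction is nonnegative. -/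
theorem lossAdj_nonneg {T : H →L[ℝ] H} (hT : ∀ y, ‖T y‖ ≤ ‖y‖) (ζ : H) : 0 ≤ ‖ζ‖ ^ 2 - ‖ContinuousLinearMap.adjoint T ζ‖ ^ 2 :=
  loss_nonneg (norm_adjoint_le hT) ζ

omit [CompleteSpace H] in
/-- **The loss is a quadratic form**: `q(a + b) ≤ 2 q(a) + 2 q(b)` for a contraction (parallelogram law for `‖·‖` and for `‖T·‖`, and `q(a − b) ≥ 0`). -/
theorem loss_add_le {T : H →L[ℝ] H} (hT : ∀ y, ‖T y‖ ≤ ‖y‖) (a b : H) :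
    ‖a + b‖ ^ 2 - ‖T (a + b)‖ ^ 2 ≤ 2 * (‖a‖ ^ 2 - ‖T a‖ ^ 2) + 2 * (‖b‖ ^ 2 - ‖T b‖ ^ 2) := by
  have p1 := parallelogram_law_with_norm ℝ a b
  have p2 := parallelogram_law_with_norm ℝ (T a) (T b)
  rw [← map_add, ← map_sub] at p2
  have h3 := loss_nonneg hT (a - b)
  nlinarith [p1, p2, h3]

/-! ## §2 Monotonicity under composition (telescoping) -/

omit [CompleteSpace H] in
/-- `q_{T₁}(x) ≤ q_{T₂ ∘ T₁}(x)` for a contraction `T₂`. -/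
theorem loss_le_loss_comp {T₁ T₂ : H →L[ℝ] H} (hT₂ : ∀ y, ‖T₂ y‖ ≤ ‖y‖) (x : H) :
    ‖x‖ ^ 2 - ‖T₁ x‖ ^ 2 ≤ ‖x‖ ^ 2 - ‖(T₂.comp T₁) x‖ ^ 2 := by
  have h := hT₂ (T₁ x)
  rw [ContinuousLinearMap.comp_apply]
  nlinarith [norm_nonneg (T₂ (T₁ x))]

omit [CompleteSpace H] in
/-- `q_{T₂}(T₁ x) ≤ q_{T₂ ∘ T₁}(x)` for a contraction `T₁`. -/
theorem loss_apply_le_loss_comp {T₁ T₂ : H →L[ℝ] H} (hT₁ : ∀ y, ‖T₁ y‖ ≤ ‖y‖) (x : H) :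
    ‖T₁ x‖ ^ 2 - ‖T₂ (T₁ x)‖ ^ 2 ≤ ‖x‖ ^ 2 - ‖(T₂.comp T₁) x‖ ^ 2 := by
  have h := hT₁ x
  rw [ContinuousLinearMap.comp_apply]
  nlinarith [norm_nonneg (T₁ x)]

/-- `q*_{T₁}(T₂† ζ) ≤ q*_{T₂ ∘ T₁}(ζ)` for a contraction `T₂` (`(T₂T₁)† = T₁†T₂†`). -/
theorem lossAdj_adjoint_le_lossAdj_comp {T₁ T₂ : H →L[ℝ] H} (hT₂ : ∀ y, ‖T₂ y‖ ≤ ‖y‖) (ζ : H) :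
    ‖ContinuousLinearMap.adjoint T₂ ζ‖ ^ 2 - ‖ContinuousLinearMap.adjoint T₁ (ContinuousLinearMap.adjoint T₂ ζ)‖ ^ 2
      ≤ ‖ζ‖ ^ 2 - ‖ContinuousLinearMap.adjoint (T₂.comp T₁) ζ‖ ^ 2 := by
  rw [ContinuousLinearMap.adjoint_comp, ContinuousLinearMap.comp_apply]
  have h := norm_adjoint_le hT₂ ζ
  nlinarith [norm_nonneg (ContinuousLinearMap.adjoint T₂ ζ)]

/-- `q*_{T₂}(ζ) ≤ q*_{T₂ ∘ T₁}(ζ)` for a contraction `T₁`. -/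
theorem lossAdj_le_lossAdj_comp {T₁ T₂ : H →L[ℝ] H} (hT₁ : ∀ y, ‖T₁ y‖ ≤ ‖y‖) (ζ : H) :
    ‖ζ‖ ^ 2 - ‖ContinuousLinearMap.adjoint T₂ ζ‖ ^ 2 ≤ ‖ζ‖ ^ 2 - ‖ContinuousLinearMap.adjoint (T₂.comp T₁) ζ‖ ^ 2 := by
  rw [ContinuousLinearMap.adjoint_comp, ContinuousLinearMap.comp_apply]
  have h := norm_adjoint_le hT₁ (ContinuousLinearMap.adjoint T₂ ζ)
  nlinarith [norm_nonneg (ContinuousLinearMap.adjoint T₁ (ContinuousLinearMap.adjoint T₂ ζ))]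

/-! ## §3 The strong bound from the loss-currency bound -/

/-- **Testing against itself**: if `|⟪U x − T x, ζ⟫| ≤ η √q_T(x) √q*_T(ζ)` for all `ζ`, then `‖U x − T x‖ ≤ η √q_T(x)` (`q*_T(ζ) ≤ ‖ζ‖²`). -/
theorem norm_sub_le_of_lossBound {U T : H →L[ℝ] H} {η : ℝ} (hη : 0 ≤ η) (x : H)
    (h : ∀ ζ : H, |⟪U x - T x, ζ⟫_ℝ| ≤ η * Real.sqrt (‖x‖ ^ 2 - ‖T x‖ ^ 2) * Real.sqrt (‖ζ‖ ^ 2 - ‖ContinuousLinearMap.adjoint T ζ‖ ^ 2)) :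
    ‖U x - T x‖ ≤ η * Real.sqrt (‖x‖ ^ 2 - ‖T x‖ ^ 2) := by
  set ζ := U x - T x with hζ
  have h1 := h ζ
  rw [real_inner_self_eq_norm_sq, abs_of_nonneg (sq_nonneg _)] at h1
  have h2 : Real.sqrt (‖ζ‖ ^ 2 - ‖ContinuousLinearMap.adjoint T ζ‖ ^ 2) ≤ ‖ζ‖ := by
    rw [← Real.sqrt_sq (norm_nonneg ζ)]
    exact Real.sqrt_le_sqrt (by rw [Real.sqrt_sq (norm_nonneg ζ)]; nlinarith [norm_nonneg (ContinuousLinearMap.adjoint T ζ)])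
  have hA : 0 ≤ η * Real.sqrt (‖x‖ ^ 2 - ‖T x‖ ^ 2) := mul_nonneg hη (Real.sqrt_nonneg _)
  have h3 : ‖ζ‖ ^ 2 ≤ η * Real.sqrt (‖x‖ ^ 2 - ‖T x‖ ^ 2) * ‖ζ‖ := h1.trans (mul_le_mul_of_nonneg_left h2 hA)
  by_cases h0 : ‖ζ‖ = 0
  · rw [h0]; exact hA
  · have hp : 0 < ‖ζ‖ := lt_of_le_of_ne (norm_nonneg _) (Ne.symm h0)
    nlinarith

/-! ## §4 Composition across a frame reset -/

/-- **COMPOSITION of loss-currency bounds.**  If `(U₁, T₁)` and `(U₂, T₂)` (`T₁, T₂` contractions) satisfy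
`|⟪(Uᵢ − Tᵢ)x, ζ⟫| ≤ ηᵢ √q_{Tᵢ}(x) √q*_{Tᵢ}(ζ)` for all `x, ζ`, then for all `x, ζ`
`|⟪(U₂U₁ − T₂T₁)x, ζ⟫| ≤ (η₁ + η₂)·√(2 + 2η₁²) · √q_{T₂T₁}(x) · √q*_{T₂T₁}(ζ)`
(`U₂U₁ − T₂T₁ = (U₂ − T₂)U₁ + T₂(U₁ − T₁)`; `q_{T₂}(U₁x) ≤ 2q_{T₂T₁}(x) + 2‖(U₁−T₁)x‖² ≤ (2+2η₁²)q_{T₂T₁}(x)`; `q*_{T₁}(T₂†ζ), q*_{T₂}(ζ) ≤ q*_{T₂T₁}(ζ)`). -/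
theorem lossBound_comp {U₁ T₁ U₂ T₂ : H →L[ℝ] H} {η₁ η₂ : ℝ} (hη₁ : 0 ≤ η₁) (hη₂ : 0 ≤ η₂)
    (hT₁ : ∀ y, ‖T₁ y‖ ≤ ‖y‖) (hT₂ : ∀ y, ‖T₂ y‖ ≤ ‖y‖)
    (h₁ : ∀ x ζ : H, |⟪U₁ x - T₁ x, ζ⟫_ℝ| ≤ η₁ * Real.sqrt (‖x‖ ^ 2 - ‖T₁ x‖ ^ 2) * Real.sqrt (‖ζ‖ ^ 2 - ‖ContinuousLinearMap.adjoint T₁ ζ‖ ^ 2))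
    (h₂ : ∀ x ζ : H, |⟪U₂ x - T₂ x, ζ⟫_ℝ| ≤ η₂ * Real.sqrt (‖x‖ ^ 2 - ‖T₂ x‖ ^ 2) * Real.sqrt (‖ζ‖ ^ 2 - ‖ContinuousLinearMap.adjoint T₂ ζ‖ ^ 2))
    (x ζ : H) :
    |⟪U₂ (U₁ x) - T₂ (T₁ x), ζ⟫_ℝ|
      ≤ (η₁ + η₂) * Real.sqrt (2 + 2 * η₁ ^ 2) * Real.sqrt (‖x‖ ^ 2 - ‖(T₂.comp T₁) x‖ ^ 2)
        * Real.sqrt (‖ζ‖ ^ 2 - ‖ContinuousLinearMap.adjoint (T₂.comp T₁) ζ‖ ^ 2) := by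
  -- the four losses of the composite
  set Q : ℝ := ‖x‖ ^ 2 - ‖(T₂.comp T₁) x‖ ^ 2 with hQ
  set Qs : ℝ := ‖ζ‖ ^ 2 - ‖ContinuousLinearMap.adjoint (T₂.comp T₁) ζ‖ ^ 2 with hQs
  have hQ0 : 0 ≤ Q := loss_nonneg (fun y => (hT₂ (T₁ y)).trans (hT₁ y)) x
  have hQs0 : 0 ≤ Qs := lossAdj_nonneg (fun y => by rw [ContinuousLinearMap.comp_apply]; exact (hT₂ (T₁ y)).trans (hT₁ y)) ζ
  -- split
  have hsplit : U₂ (U₁ x) - T₂ (T₁ x) = (U₂ (U₁ x) - T₂ (U₁ x)) + T₂ (U₁ x - T₁ x) := by rw [map_sub]; abel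
  -- first term: `(U₂ − T₂)(U₁ x)` against `ζ`
  have hδ₁ : ‖U₁ x - T₁ x‖ ≤ η₁ * Real.sqrt (‖x‖ ^ 2 - ‖T₁ x‖ ^ 2) := norm_sub_le_of_lossBound hη₁ x (h₁ x)
  have hq2 : ‖U₁ x‖ ^ 2 - ‖T₂ (U₁ x)‖ ^ 2 ≤ (2 + 2 * η₁ ^ 2) * Q := by
    have e : U₁ x = T₁ x + (U₁ x - T₁ x) := by abel
    have h1 := loss_add_le hT₂ (T₁ x) (U₁ x - T₁ x)
    rw [← e] at h1
    have h2 : ‖T₁ x‖ ^ 2 - ‖T₂ (T₁ x)‖ ^ 2 ≤ Q := loss_apply_le_loss_comp hT₁ x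
    have h3 : ‖U₁ x - T₁ x‖ ^ 2 - ‖T₂ (U₁ x - T₁ x)‖ ^ 2 ≤ ‖U₁ x - T₁ x‖ ^ 2 := by nlinarith [norm_nonneg (T₂ (U₁ x - T₁ x))]
    have h4 : ‖U₁ x - T₁ x‖ ^ 2 ≤ η₁ ^ 2 * (‖x‖ ^ 2 - ‖T₁ x‖ ^ 2) := by
      have h0 : 0 ≤ ‖x‖ ^ 2 - ‖T₁ x‖ ^ 2 := loss_nonneg hT₁ x
      calc ‖U₁ x - T₁ x‖ ^ 2 ≤ (η₁ * Real.sqrt (‖x‖ ^ 2 - ‖T₁ x‖ ^ 2)) ^ 2 := pow_le_pow_left₀ (norm_nonneg _) hδ₁ 2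
        _ = η₁ ^ 2 * (‖x‖ ^ 2 - ‖T₁ x‖ ^ 2) := by rw [mul_pow, Real.sq_sqrt h0]
    have h5 : ‖x‖ ^ 2 - ‖T₁ x‖ ^ 2 ≤ Q := loss_le_loss_comp hT₂ x
    nlinarith [sq_nonneg η₁]
  have hqs2 : ‖ζ‖ ^ 2 - ‖ContinuousLinearMap.adjoint T₂ ζ‖ ^ 2 ≤ Qs := lossAdj_le_lossAdj_comp hT₁ ζ
  have hA := h₂ (U₁ x) ζ
  have hA' : |⟪U₂ (U₁ x) - T₂ (U₁ x), ζ⟫_ℝ| ≤ η₂ * Real.sqrt ((2 + 2 * η₁ ^ 2) * Q) * Real.sqrt Qs := by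
    refine hA.trans ?_
    gcongr
  -- second term: `T₂ (U₁ − T₁) x` against `ζ` = `(U₁ − T₁)x` against `T₂† ζ`
  have hB := h₁ x (ContinuousLinearMap.adjoint T₂ ζ)
  have hB0 : ⟪T₂ (U₁ x - T₁ x), ζ⟫_ℝ = ⟪U₁ x - T₁ x, ContinuousLinearMap.adjoint T₂ ζ⟫_ℝ := by
    rw [ContinuousLinearMap.adjoint_inner_right]
  have hq1 : ‖x‖ ^ 2 - ‖T₁ x‖ ^ 2 ≤ Q := loss_le_loss_comp hT₂ x
  have hqs1 : ‖ContinuousLinearMap.adjoint T₂ ζ‖ ^ 2 - ‖ContinuousLinearMap.adjoint T₁ (ContinuousLinearMap.adjoint T₂ ζ)‖ ^ 2 ≤ Qs :=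
    lossAdj_adjoint_le_lossAdj_comp hT₂ ζ
  have hB' : |⟪T₂ (U₁ x - T₁ x), ζ⟫_ℝ| ≤ η₁ * Real.sqrt Q * Real.sqrt Qs := by
    rw [hB0]
    refine hB.trans ?_
    gcongr
  -- assemble
  have htri : |⟪U₂ (U₁ x) - T₂ (T₁ x), ζ⟫_ℝ| ≤ |⟪U₂ (U₁ x) - T₂ (U₁ x), ζ⟫_ℝ| + |⟪T₂ (U₁ x - T₁ x), ζ⟫_ℝ| := by
    rw [hsplit, inner_add_left]
    exact abs_add_le _ _
  have hsq : Real.sqrt ((2 + 2 * η₁ ^ 2) * Q) = Real.sqrt (2 + 2 * η₁ ^ 2) * Real.sqrt Q := Real.sqrt_mul (by positivity) Q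
  rw [hsq] at hA'
  have hR1 : 1 ≤ Real.sqrt (2 + 2 * η₁ ^ 2) := by
    rw [show (1:ℝ) = Real.sqrt 1 by simp]
    exact Real.sqrt_le_sqrt (by nlinarith [sq_nonneg η₁])
  have hSQ : 0 ≤ Real.sqrt Q := Real.sqrt_nonneg _
  have hSQs : 0 ≤ Real.sqrt Qs := Real.sqrt_nonneg _
  calc |⟪U₂ (U₁ x) - T₂ (T₁ x), ζ⟫_ℝ|
      ≤ η₂ * (Real.sqrt (2 + 2 * η₁ ^ 2) * Real.sqrt Q) * Real.sqrt Qs + η₁ * Real.sqrt Q * Real.sqrt Qs := htri.trans (add_le_add hA' hB')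
    _ ≤ (η₁ + η₂) * Real.sqrt (2 + 2 * η₁ ^ 2) * Real.sqrt Q * Real.sqrt Qs := by
        have : η₁ * Real.sqrt Q * Real.sqrt Qs ≤ η₁ * (Real.sqrt (2 + 2 * η₁ ^ 2) * Real.sqrt Q) * Real.sqrt Qs := by
          have := mul_le_mul_of_nonneg_left hR1 hη₁
          nlinarith [mul_nonneg (mul_nonneg hη₁ hSQ) hSQs, mul_nonneg hSQ hSQs]
        nlinarith

end Summit.AnomalousDissipation.AnomalousDissipation.Theorems.SolenoidalFractalHomogenisation.LagrangianStep.LossCurrency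

end
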